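import Literature.Computability.Cryptography.QuantumCircuitDescFP
import Literature.Computability.QuantumComplexity.CircuitEmbedding
import Literature.Computability.Complexity.ListBricks
import Literature.Computability.Complexity.FoldBricks
import HarnessLib

/-!
# Renumbering the wires of a circuit description in polynomial time

Topic `Literature/Computability/QuantumComplexity`; a string-level brick for uniformity proofs of
circuit families that *transport* the circuits of a given uniform family along a wire embedding
(`mapWires E C`, `CircuitEmbedding.lean`) whose values are not the identity — the tidy subroutines
placed after the query register (`TidyBlock.lean`, embedding `Fin.natAddEmb (k + 1)`) and the blocks
substituted for the oracle gates of a family (`OracleSubstitution.lean`, embedding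
`OracleImpl.blockEmb e off a`: the first `k + 1` wires along the table `e`, the others shifted to
`off`), in the discharge of `isQSolvable_of_mem_BQP_oracle` (Bennett–Bernstein–Brassard–Vazirani
1997, Cor. 4.15). The description of the transported circuit is the description of the circuit with
every wire numeral `w` replaced by `ρ(w)`, where

  `ρ(w) = T[w]` if `w < |T|`, and `ρ(w) = off + (w − |T|)` otherwise   (`RenumDesc.wmap T off`),

for a table `T : List ℕ` and an offset `off` (`encode_mapWiresGate_of_wmap`).

* `RenumDesc.wireF` — the wire numeral transformer on items `⟨x, ⟨prm, bin w⟩⟩` with parameters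
  `prm = ⟨bin |T|, ⟨encList (T.map bin), bin off⟩⟩` (`prmOf T off`): comparison `ltFn`, table
  look-up `nthLF`, arithmetic `subFn`/`addFn`, branching `iteFn`, clipped to the yardstick length
  `|x|` (`takeFn`) so that it has the growth bound `mapLF` requires on *every* input;
* `RenumDesc.codeF` — the gate-code transformer: a code `tag :: ⟨num, ⟨1^arity, encList wires⟩⟩`
  (`QGate.encode`) keeps its tag, symbol numeral and arity and maps its wire list by
  `mapLF wireF` (`ListBricks.lean`);
* `RenumDesc.renumF` — **the description transformer** `⟨x, ⟨prm, encList codes⟩⟩ ↦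
  encList (codes renumbered)` (`mapLF codeF` with `|x|` rounds), `renumF_mem_FP`, and its value
  **`renumF_apply`**: on the gate codes of a circuit, with a yardstick `x` longer than the number of
  gates, the arities, the wire numbers, the table entries and `off +` the wire numbers, it returns
  the gate codes of the circuit transported along any embedding with values `wmap T off`.

(Arora–Barak 2009, §6.1–6.2 with Remark 6.7: descriptions of circuits are processed gate by gate in
polynomial time; the list coding and the loop combinators are those of `StackLists.lean` /
`ListBricks.lean`.)

## References

* S. Arora, B. Barak, *Computational Complexity: A Modern Approach*, CUP 2009, §0.1 (coding of
  tuples and lists), §1.3 (bounded loops), §6.1–6.2, Remark 6.7 [AroraBarak2009].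
* C. H. Bennett, E. Bernstein, G. Brassard, U. Vazirani, SIAM J. Comput. 26 (1997), Cor. 4.15
  [BennettBernsteinBrassardVazirani1997].
-/

noncomputable section

namespace Literature.Computability.QuantumComplexity

namespace RenumDesc

open _root_.Computability Polynomial Complexity Complexity.Brick Plumb Cryptography

/-! ### The wire map and the parameter record -/

/-- **The wire map of a table and an offset**: `w ↦ T[w]` below `|T|`, `w ↦ off + (w − |T|)` from
`|T|` on. [folklore] -/
def wmap (T : List ℕ) (off : ℕ) (w : ℕ) : ℕ := if w < T.length then T.getD w 0 else off + (w - T.length)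

/-- `wmap` below the table length. [folklore] -/
theorem wmap_of_lt {T : List ℕ} (off : ℕ) {w : ℕ} (h : w < T.length) : wmap T off w = T[w] := by
  rw [wmap, if_pos h, List.getD_eq_getElem _ _ h]

/-- `wmap` from the table length on. [folklore] -/
theorem wmap_of_le {T : List ℕ} (off : ℕ) {w : ℕ} (h : T.length ≤ w) : wmap T off w = off + (w - T.length) := by
  rw [wmap, if_neg (Nat.not_lt.2 h)]

/-- `wmap` with the empty table is the shift by `off`. [folklore] -/
@[simp] theorem wmap_nil (off w : ℕ) : wmap [] off w = off + w := by
  rw [wmap_of_le off (by simp)]; rfl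

/-- **The parameter record** `⟨bin |T|, ⟨encList (T.map bin), bin off⟩⟩`. [folklore] -/
def prmOf (T : List ℕ) (off : ℕ) : List Bool :=
  boolPair (encodeNat T.length) (boolPair (encList (T.map encodeNat)) (encodeNat off))

/-! ### The wire transformer -/

/-- The raw wire transformer on items `z = ⟨x, ⟨prm, a⟩⟩`: `[a < cnt] ? tbl[a] : off + (a − cnt)`.
[folklore] -/
def rawWireF : List Bool → List Bool :=
  iteFn (ltFn ∘ fanoutFn (sndPow 1) (fstF ∘ nthF 1))
    (nthLF ∘ fanoutFn (nthF 0) (fanoutFn (sndPow 1) (nthF 1 ∘ nthF 1)))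
    (addFn ∘ fanoutFn (sndPow 1 ∘ nthF 1) (subFn ∘ fanoutFn (sndPow 1) (fstF ∘ nthF 1)))

/-- **The wire transformer**, clipped to the yardstick: `(rawWireF z).take |x|`. [folklore] -/
def wireF : List Bool → List Bool := takeFn ∘ fanoutFn (nthF 0) rawWireF

/-- `rawWireF ∈ FP`. [folklore] -/
theorem rawWireF_mem_FP : rawWireF ∈ FP :=
  iteFn_mem_FP (comp_mem_FP ltFn_mem_FP (fanoutFn_mem_FP (sndPow_mem_FP 1) (comp_mem_FP fstF_mem_FP (nthF_mem_FP 1))))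
    (comp_mem_FP nthLF_mem_FP (fanoutFn_mem_FP (nthF_mem_FP 0) (fanoutFn_mem_FP (sndPow_mem_FP 1) (comp_mem_FP (nthF_mem_FP 1) (nthF_mem_FP 1)))))
    (comp_mem_FP addFn_mem_FP (fanoutFn_mem_FP (comp_mem_FP (sndPow_mem_FP 1) (nthF_mem_FP 1))
      (comp_mem_FP subFn_mem_FP (fanoutFn_mem_FP (sndPow_mem_FP 1) (comp_mem_FP fstF_mem_FP (nthF_mem_FP 1))))))

/-- `wireF ∈ FP`. [folklore] -/
theorem wireF_mem_FP : wireF ∈ FP := comp_mem_FP takeFn_mem_FP (fanoutFn_mem_FP (nthF_mem_FP 0) rawWireF_mem_FP)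

/-- **Growth of the wire transformer**: at most the yardstick, on every input. [folklore] -/
theorem length_wireF_le (x p a : List Bool) : (wireF (boolPair x (boolPair p a))).length ≤ 0 * a.length + (X : Polynomial ℕ).eval x.length := by
  simp only [wireF, Function.comp_apply, fanoutFn_apply, nthF_zero_boolPair, takeFn_boolPair, eval_X, zero_mul, zero_add]
  exact List.length_take_le _ _

/-- **Value of the raw wire transformer** on a well-formed item. [folklore] -/
theorem rawWireF_apply (x : List Bool) (T : List ℕ) (off w : ℕ) (hw : w ≤ x.length) :
    rawWireF (boolPair x (boolPair (prmOf T off) (encodeNat w))) = encodeNat (wmap T off w) := by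
  have hc : (ltFn ∘ fanoutFn (sndPow 1) (fstF ∘ nthF 1)) (boolPair x (boolPair (prmOf T off) (encodeNat w))) =
      [decide (w < T.length)] := by
    simp [fanoutFn_apply, prmOf]
  unfold rawWireF
  by_cases h : w < T.length
  · rw [decide_eq_true h] at hc
    rw [iteFn_apply_true hc, wmap_of_lt off h]
    simp only [Function.comp_apply, fanoutFn_apply, nthF_zero_boolPair, sndPow_succ_boolPair, sndPow_zero_boolPair,
      nthF_succ_boolPair, prmOf]
    rw [nthLF_apply x hw, List.getD_eq_getElem _ _ (by simpa using h), List.getElem_map]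
  · rw [decide_eq_false h] at hc
    rw [iteFn_apply_false hc, wmap_of_le off (Nat.not_lt.1 h)]
    simp [fanoutFn_apply, prmOf]

/-- **Value of the wire transformer** on a well-formed item whose image is short. [folklore] -/
theorem wireF_apply (x : List Bool) (T : List ℕ) (off w : ℕ) (hw : w ≤ x.length) (hv : wmap T off w ≤ x.length) :
    wireF (boolPair x (boolPair (prmOf T off) (encodeNat w))) = encodeNat (wmap T off w) := by
  simp only [wireF, Function.comp_apply, fanoutFn_apply, nthF_zero_boolPair, takeFn_boolPair]
  rw [rawWireF_apply x T off w hw, List.take_of_length_le]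
  exact (Complexity.length_encodeNat_le_self _).trans hv

/-! ### The gate-code transformer -/

/-- The code field of an item. [folklore] -/
def cF : List Bool → List Bool := sndPow 1

/-- The code without its tag bit. [folklore] -/
def bodyF : List Bool → List Bool := dropFn ∘ fanoutFn (fun _ => [true]) cF

/-- The tag bit. [folklore] -/
def tagF : List Bool → List Bool := takeFn ∘ fanoutFn (fun _ => [true]) cF

/-- The record fed to the inner map: `⟨x, ⟨bin arity, ⟨prm, wire list⟩⟩⟩`. [folklore] -/
def innerRec : List Bool → List Bool :=
  fanoutFn (nthF 0) (fanoutFn (lenBinF ∘ nthF 1 ∘ bodyF) (fanoutFn (nthF 1) (sndPow 1 ∘ bodyF)))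

/-- **The gate-code transformer**: keep tag, symbol numeral and arity; map the wire list.
[cite: AroraBarak2009, §6.1 (descriptions of circuits)] -/
def codeF : List Bool → List Bool :=
  appF ∘ fanoutFn tagF (fanoutFn (fstF ∘ bodyF) (fanoutFn (nthF 1 ∘ bodyF) (mapLF wireF ∘ innerRec)))

/-- `codeF ∈ FP`. [folklore] -/
theorem codeF_mem_FP : codeF ∈ FP := by
  have hc : cF ∈ FP := sndPow_mem_FP 1
  have hb : bodyF ∈ FP := comp_mem_FP dropFn_mem_FP (fanoutFn_mem_FP (const_mem_FP _) hc)
  have ht : tagF ∈ FP := comp_mem_FP takeFn_mem_FP (fanoutFn_mem_FP (const_mem_FP _) hc)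
  have hi : innerRec ∈ FP := fanoutFn_mem_FP (nthF_mem_FP 0) (fanoutFn_mem_FP (comp_mem_FP lenBinF_mem_FP (comp_mem_FP (nthF_mem_FP 1) hb))
    (fanoutFn_mem_FP (nthF_mem_FP 1) (comp_mem_FP (sndPow_mem_FP 1) hb)))
  exact comp_mem_FP appF_mem_FP (fanoutFn_mem_FP ht (fanoutFn_mem_FP (comp_mem_FP fstF_mem_FP hb)
    (fanoutFn_mem_FP (comp_mem_FP (nthF_mem_FP 1) hb) (comp_mem_FP (mapLF_mem_FP wireF_mem_FP (Nat.zero_le 2) length_wireF_le) hi))))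

/-- The growth polynomial of the gate-code transformer. [folklore] -/
def codePoly : Polynomial ℕ := X * (C 2 * X + C 4) + C 5

/-- **Growth of the gate-code transformer**: `≤ 2 |c| + codePoly |x|` on every input. [folklore] -/
theorem length_codeF_le (x p c : List Bool) : (codeF (boolPair x (boolPair p c))).length ≤ 2 * c.length + codePoly.eval x.length := by
  have hbody : bodyF (boolPair x (boolPair p c)) = c.drop 1 := by simp [bodyF, cF, fanoutFn_apply]
  have htag : (tagF (boolPair x (boolPair p c))).length ≤ 1 := by
    simp only [tagF, cF, Function.comp_apply, fanoutFn_apply, sndPow_succ_boolPair, sndPow_zero_boolPair, takeFn_boolPair,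
      List.length_singleton]
    exact (List.length_take_le _ _)
  have h1 := length_fstF_sndF_le (c.drop 1)
  have h2 := length_fstF_sndF_le (sndF (c.drop 1))
  have hdrop : (c.drop 1).length ≤ c.length := by rw [List.length_drop]; exact Nat.sub_le _ _
  have hin : innerRec (boolPair x (boolPair p c)) =
      boolPair x (boolPair (lenBinF (nthF 1 (c.drop 1))) (boolPair p (sndPow 1 (c.drop 1)))) := by
    simp [innerRec, fanoutFn_apply, hbody]
  have hmap := length_mapLF_le (f := wireF) 0 length_wireF_le (innerRec (boolPair x (boolPair p c)))
  rw [hin] at hmap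
  simp only [fstF_boolPair, sndPow_succ_boolPair, sndPow_zero_boolPair, zero_mul, zero_add, eval_X] at hmap
  simp only [codeF, Function.comp_apply, fanoutFn_apply, appF, fstF_boolPair, sndF_boolPair, List.length_append, length_boolPair, hbody]
  have hn1 : (nthF 1 (c.drop 1)).length = (fstF (sndF (c.drop 1))).length := rfl
  have hp : codePoly.eval x.length = x.length * (2 * x.length + 4) + 5 := by simp [codePoly]
  rw [hp, hin, hn1]
  linarith [hmap, h1, h2, hdrop, htag]

/-! ### Gate codes -/

section Codes

variable {G : QGateSet} [Encodable G.Op] {N M : ℕ}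

/-- The wire list of a list encoding of naturals is the pair list of the binary numerals after the
unary length. [cite: AroraBarak2009, §0.1 (coding of lists)] -/
theorem listNat_encode_eq (ws : List ℕ) :
    encodingListNatBool.encode ws = boolPair (unaryEncodeNat ws.length) (encList (ws.map encodeNat)) := by
  change boolPair (unaryEncodeNat ws.length) (ws.foldr (fun a acc => boolPair (encodeNat a) acc) []) = _
  congr 1
  induction ws with
  | nil => rfl
  | cons a ws ih => rw [List.foldr_cons, List.map_cons, encList_cons, ih]

/-- The tag, numeral and wire list of a gate code. [folklore] -/
def parts : QGate G N → Bool × ℕ × List ℕ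
  | .gate g e => (false, Encodable.encode g, List.ofFn fun i => (e i : ℕ))
  | .oracle k e => (true, k, List.ofFn fun i => (e i : ℕ))

/-- **The shape of a gate code**: `tag :: ⟨bin num, ⟨1^{arity}, encList (wires in binary)⟩⟩`.
[cite: AroraBarak2009, §6.1 (descriptions of circuits)] -/
theorem encode_eq_parts (g : QGate G N) :
    g.encode = (parts g).1 :: boolPair (encodeNat (parts g).2.1)
      (boolPair (unaryEncodeNat (parts g).2.2.length) (encList ((parts g).2.2.map encodeNat))) := by
  cases g with
  | gate s e =>
    change false :: boolPair (encodeNat (Encodable.encode s)) (encodingListNatBool.encode (List.ofFn fun i => (e i : ℕ))) = _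
    rw [listNat_encode_eq]; rfl
  | oracle k e =>
    change true :: boolPair (encodeNat k) (encodingListNatBool.encode (List.ofFn fun i => (e i : ℕ))) = _
    rw [listNat_encode_eq]; rfl

/-- Transporting a gate keeps tag and numeral and maps the wire list. [folklore] -/
theorem parts_mapWiresGate (ρ : Fin N ↪ Fin M) (g : QGate G N) :
    parts (mapWiresGate ρ g) = ((parts g).1, (parts g).2.1, (parts g).2.2.map fun w => if h : w < N then (ρ ⟨w, h⟩ : ℕ) else 0) := by
  cases g with
  | gate s e =>
    refine Prod.ext rfl (Prod.ext rfl ?_)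
    change (List.ofFn fun i => ((e.trans ρ) i : ℕ)) = (List.ofFn fun i => (e i : ℕ)).map _
    rw [List.map_ofFn]
    congr 1
    funext i
    simp only [Function.comp_apply, Function.Embedding.trans_apply, dif_pos (e i).isLt, Fin.eta]
  | oracle k e =>
    refine Prod.ext rfl (Prod.ext rfl ?_)
    change (List.ofFn fun i => ((e.trans ρ) i : ℕ)) = (List.ofFn fun i => (e i : ℕ)).map _
    rw [List.map_ofFn]
    congr 1
    funext i
    simp only [Function.comp_apply, Function.Embedding.trans_apply, dif_pos (e i).isLt, Fin.eta]

/-- Every wire number of a gate is below the width. [folklore] -/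
theorem lt_of_mem_parts (g : QGate G N) {w : ℕ} (hw : w ∈ (parts g).2.2) : w < N := by
  cases g with
  | gate s e =>
    simp only [parts, List.mem_ofFn] at hw
    obtain ⟨i, rfl⟩ := hw; exact (e i).isLt
  | oracle k e =>
    simp only [parts, List.mem_ofFn] at hw
    obtain ⟨i, rfl⟩ := hw; exact (e i).isLt

/-- The arity of a gate is at most the width. [folklore] -/
theorem length_parts_le (g : QGate G N) : (parts g).2.2.length ≤ N := by
  cases g with
  | gate s e =>
    simp only [parts, List.length_ofFn]
    simpa using Fintype.card_le_of_embedding e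
  | oracle k e =>
    simp only [parts, List.length_ofFn]
    simpa using Fintype.card_le_of_embedding e

/-- **The description of a transported gate**, when the embedding realises `wmap T off`.
[cite: AroraBarak2009, §6.1 (descriptions of circuits)] -/
theorem encode_mapWiresGate_of_wmap (T : List ℕ) (off : ℕ) (ρ : Fin N ↪ Fin M) (hρ : ∀ i : Fin N, (ρ i : ℕ) = wmap T off i)
    (g : QGate G N) :
    (mapWiresGate ρ g).encode = (parts g).1 :: boolPair (encodeNat (parts g).2.1)
      (boolPair (unaryEncodeNat (parts g).2.2.length) (encList ((parts g).2.2.map fun w => encodeNat (wmap T off w)))) := by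
  rw [encode_eq_parts, parts_mapWiresGate]
  simp only [List.length_map, List.map_map]
  congr 4
  refine List.map_congr_left fun w hw => ?_
  simp only [Function.comp_apply]
  rw [dif_pos (lt_of_mem_parts g hw), hρ]

end Codes

/-! ### Value of the gate-code transformer -/

/-- **Value of `codeF` on a code of the gate shape** `tag :: ⟨bin num, ⟨1^{|ws|}, encList (ws in binary)⟩⟩`
with a long enough yardstick: the wire list is renumbered. [folklore] -/
theorem codeF_apply_code (x : List Bool) (T : List ℕ) (off : ℕ) (tag : Bool) (num : ℕ) (ws : List ℕ)
    (hws : ws.length ≤ x.length) (hw : ∀ w ∈ ws, w ≤ x.length) (hv : ∀ w ∈ ws, wmap T off w ≤ x.length) :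
    codeF (boolPair x (boolPair (prmOf T off)
      (tag :: boolPair (encodeNat num) (boolPair (unaryEncodeNat ws.length) (encList (ws.map encodeNat)))))) =
      tag :: boolPair (encodeNat num) (boolPair (unaryEncodeNat ws.length) (encList (ws.map fun w => encodeNat (wmap T off w)))) := by
  have hlen : (unaryEncodeNat ws.length).length = ws.length := Computability.unary_decode_encode_nat ws.length
  have hbody : ∀ p : List Bool, bodyF (boolPair x (boolPair p
      (tag :: boolPair (encodeNat num) (boolPair (unaryEncodeNat ws.length) (encList (ws.map encodeNat)))))) =
        boolPair (encodeNat num) (boolPair (unaryEncodeNat ws.length) (encList (ws.map encodeNat))) := fun p => by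
    rw [bodyF, cF, Function.comp_apply, fanoutFn_apply, sndPow_succ_boolPair, sndPow_zero_boolPair, dropFn_boolPair,
      List.length_singleton, List.drop_succ_cons, List.drop_zero]
  have htag : ∀ p : List Bool, tagF (boolPair x (boolPair p
      (tag :: boolPair (encodeNat num) (boolPair (unaryEncodeNat ws.length) (encList (ws.map encodeNat)))))) = [tag] := fun p => by
    rw [tagF, cF, Function.comp_apply, fanoutFn_apply, sndPow_succ_boolPair, sndPow_zero_boolPair, takeFn_boolPair,
      List.length_singleton, List.take_succ_cons, List.take_zero]
  have hmap : mapLF wireF (boolPair x (boolPair (encodeNat ws.length) (boolPair (prmOf T off) (encList (ws.map encodeNat))))) =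
      encList (ws.map fun w => encodeNat (wmap T off w)) := by
    have h := mapLF_apply wireF x (prmOf T off) hws (ws.map encodeNat)
    rw [List.take_of_length_le (by rw [List.length_map])] at h
    rw [h, List.map_map]
    refine congrArg encList (List.map_congr_left fun w hwm => ?_)
    simp only [Function.comp_apply]
    exact wireF_apply x T off w (hw w hwm) (hv w hwm)
  have hin : innerRec (boolPair x (boolPair (prmOf T off) (tag :: boolPair (encodeNat num) (boolPair (unaryEncodeNat ws.length) (encList (ws.map encodeNat)))))) = boolPair x (boolPair (encodeNat ws.length) (boolPair (prmOf T off) (encList (ws.map encodeNat)))) := by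
    rw [innerRec, fanoutFn_apply, fanoutFn_apply, fanoutFn_apply, nthF_zero_boolPair, Function.comp_apply, Function.comp_apply,
      hbody, nthF_succ_boolPair, nthF_zero_boolPair, lenBinF_apply, hlen, nthF_succ_boolPair, nthF_zero_boolPair,
      Function.comp_apply, hbody, sndPow_succ_boolPair, sndPow_zero_boolPair]
  have h1 : tagF (boolPair x (boolPair (prmOf T off) (tag :: boolPair (encodeNat num) (boolPair (unaryEncodeNat ws.length) (encList (ws.map encodeNat)))))) = [tag] := htag _
  have h2 : (fstF ∘ bodyF) (boolPair x (boolPair (prmOf T off) (tag :: boolPair (encodeNat num) (boolPair (unaryEncodeNat ws.length) (encList (ws.map encodeNat)))))) = encodeNat num := by rw [Function.comp_apply, hbody, fstF_boolPair]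
  have h3 : (nthF 1 ∘ bodyF) (boolPair x (boolPair (prmOf T off) (tag :: boolPair (encodeNat num) (boolPair (unaryEncodeNat ws.length) (encList (ws.map encodeNat)))))) = unaryEncodeNat ws.length := by rw [Function.comp_apply, hbody, nthF_succ_boolPair, nthF_zero_boolPair]
  have h4 : (mapLF wireF ∘ innerRec) (boolPair x (boolPair (prmOf T off) (tag :: boolPair (encodeNat num) (boolPair (unaryEncodeNat ws.length) (encList (ws.map encodeNat)))))) = encList (ws.map fun w => encodeNat (wmap T off w)) := by rw [Function.comp_apply, hin, hmap]
  rw [codeF, Function.comp_apply, fanoutFn_apply, fanoutFn_apply, fanoutFn_apply, h1, h2, h3, h4, appF, fstF_boolPair, sndF_boolPair,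
    List.singleton_append]

/-- **Value of `codeF` on a gate code** with a long enough yardstick: the code of the transported
gate. [cite: AroraBarak2009, §6.1 (descriptions of circuits)] -/
theorem codeF_apply {G : QGateSet} [Encodable G.Op] {N M : ℕ} (x : List Bool) (T : List ℕ) (off : ℕ)
    (ρ : Fin N ↪ Fin M) (hρ : ∀ i : Fin N, (ρ i : ℕ) = wmap T off i) (g : QGate G N)
    (hN : N ≤ x.length) (hv : ∀ w, w < N → wmap T off w ≤ x.length) :
    codeF (boolPair x (boolPair (prmOf T off) g.encode)) = (mapWiresGate ρ g).encode := by
  rw [encode_eq_parts g, encode_mapWiresGate_of_wmap T off ρ hρ g]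
  exact codeF_apply_code x T off _ _ _ ((length_parts_le g).trans hN)
    (fun w hw => (lt_of_mem_parts g hw).le.trans hN) (fun w hw => hv w (lt_of_mem_parts g hw))

/-! ### The description transformer -/

/-- **The description transformer**: `⟨x, ⟨prm, encList codes⟩⟩ ↦ encList (codes renumbered)`
(`|x|` rounds of `mapLF codeF`). [cite: AroraBarak2009, §6.2 Remark 6.7 (descriptions processed gate by gate in polynomial time)] -/
def renumF : List Bool → List Bool :=
  mapLF codeF ∘ fanoutFn (nthF 0) (fanoutFn (lenBinF ∘ nthF 0) (fanoutFn (nthF 1) (sndPow 1)))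

/-- **`renumF ∈ FP`.** [cite: AroraBarak2009, §1.3 (bounded loops)] -/
theorem renumF_mem_FP : renumF ∈ FP :=
  comp_mem_FP (mapLF_mem_FP codeF_mem_FP le_rfl length_codeF_le)
    (fanoutFn_mem_FP (nthF_mem_FP 0) (fanoutFn_mem_FP (comp_mem_FP lenBinF_mem_FP (nthF_mem_FP 0)) (fanoutFn_mem_FP (nthF_mem_FP 1) (sndPow_mem_FP 1))))

/-- **Value of the description transformer on the gate codes of a circuit**: the gate codes of the
circuit transported along any embedding realising `wmap T off`, provided the yardstick `x` is at
least the number of gates, the width, and every renumbered wire. [cite: AroraBarak2009, §6.2 Remark 6.7] -/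
theorem renumF_apply {G : QGateSet} [Encodable G.Op] {N M : ℕ} (x : List Bool) (T : List ℕ) (off : ℕ)
    (ρ : Fin N ↪ Fin M) (hρ : ∀ i : Fin N, (ρ i : ℕ) = wmap T off i) (gs : List (QGate G N))
    (hlen : gs.length ≤ x.length) (hN : N ≤ x.length) (hv : ∀ w, w < N → wmap T off w ≤ x.length) :
    renumF (boolPair x (boolPair (prmOf T off) (encList (gs.map QGate.encode)))) =
      encList ((gs.map (mapWiresGate ρ)).map QGate.encode) := by
  have hrec : (fanoutFn (nthF 0) (fanoutFn (lenBinF ∘ nthF 0) (fanoutFn (nthF 1) (sndPow 1))))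
      (boolPair x (boolPair (prmOf T off) (encList (gs.map QGate.encode)))) =
        boolPair x (boolPair (encodeNat x.length) (boolPair (prmOf T off) (encList (gs.map QGate.encode)))) := by
    rw [fanoutFn_apply, fanoutFn_apply, fanoutFn_apply, nthF_zero_boolPair, Function.comp_apply, nthF_zero_boolPair,
      lenBinF_apply, nthF_succ_boolPair, nthF_zero_boolPair, sndPow_succ_boolPair, sndPow_zero_boolPair]
  have happly := mapLF_apply codeF x (prmOf T off) (le_refl x.length) (gs.map QGate.encode)
  rw [List.take_of_length_le (by rw [List.length_map]; exact hlen)] at happly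
  rw [renumF, Function.comp_apply, hrec, happly, List.map_map, List.map_map]
  refine congrArg encList (List.map_congr_left fun g _ => ?_)
  simp only [Function.comp_apply]
  exact codeF_apply x T off ρ hρ g hN hv

/-- **The description of a transported circuit** is `renumF` of the description of the circuit.
[cite: AroraBarak2009, §6.2 Remark 6.7] -/
theorem encode_mapWires_eq_renumF {G : QGateSet} [Encodable G.Op] {N M : ℕ} (x : List Bool) (T : List ℕ) (off : ℕ)
    (ρ : Fin N ↪ Fin M) (hρ : ∀ i : Fin N, (ρ i : ℕ) = wmap T off i) (C : QCircuit G N)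
    (hlen : C.size ≤ x.length) (hN : N ≤ x.length) (hv : ∀ w, w < N → wmap T off w ≤ x.length) :
    (mapWires ρ C).encode = renumF (boolPair x (boolPair (prmOf T off) C.encode)) := by
  rw [QCircuit.encode_eq_encList, QCircuit.encode_eq_encList, renumF_apply x T off ρ hρ C.gates hlen hN hv]
  rfl

end RenumDesc

end Literature.Computability.QuantumComplexity

end
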